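import Summits.CriticalPhenomena.PercolationContinuityZ3.Theorems.FK.Transplant.KNFreeLawSupport
import HarnessLib

/-!
# FK-continuity transplant, FT-05a (almost-sure part): under the transplant's law `fkLaw Λ W q`, weight-zero pairs are
# closed a.s., weight-one pairs inside `Λ` are open a.s., and `{0,1}`-pinned pairs follow their pattern a.s.

Cell `fk-continuity` (bschramm), FRONTIER TRANSPLANT sub-cell, registry row FT-05a (the `fkLaw` API, writer fkt-p3; these
are fkt-p2's law-interface hypotheses `LawNull` / `LawOne` (FT-04 `KNFreeLawInterfaces`) and the `null` field of fkt-p4's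
`IsPinningLaw` (FT-06b/06d) in `fkLaw` form); support file (`--supports stmt-CriticalPhenomena-4575`); builds on p205010
(kernel theorem, internal audit signed; external expert review pending). HONEST FRAMING: the transplant
`ufsc0_of_freeBoundaryHypothesis_r0` this file serves is CONDITIONAL on the free-boundary penetration hypothesis FH (open
at the same `p` for `q > 1`; ⇔ GRC Conj. (5.103) via the referee's calibration K1; barrier note
`Literature.Barriers.CriticalPhenomena.SamePFreeBoundaryCriteria`, theorem `samePFreeBoundaryCriteria`, p243859); it is a
typed reduction, not a proof of FK continuity. THIS file is unconditional finite-volume measure theory: no named facts,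
no sorries, standard axioms; nothing here is specific to `q = 2` or to `d = 3`.

## What is here (`0 < q` throughout)

In the transplant's weightings a revealed-closed or deleted edge has parameter `0` and a revealed-open (wired) edge has
parameter `1` (KN's pinning device, `pinW`; Grimmett 2006 Thm. (3.7): conditioning = pinning). Under `fkLaw Λ W q`:

* `fkLaw_apply_eq_zero_of_preimage_eq_empty`, `fkLaw_ae_subset_range` — the configuration is a lift: every open pair is
  the image of a pair of `↥Λ`, almost surely;
* `rcMeasureW_real_setOf_mem_eq_zero`, `fkLaw_setOf_mem_eq_zero_of_eq_zero`, `fkLaw_ae_not_mem_of_eq_zero` —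
  **weight-zero pairs are closed almost surely** (fkt-p2's `LawNull`);
* `fkLaw_ae_mem_of_eq_one`, `fkLaw_ae_mem_of_eq_one_of_mem_wireSet` — **weight-one pairs inside `Λ` are open almost
  surely** (`LawOne`; from `fkLaw_real_inter_setOf_subset_eq`, `KNFreeLawSupport.lean`);
* `fkLaw_ae_mem_localCylinder`, `fkLaw_real_compl_localCylinder_eq_zero` — for a set `K` of pairs inside `Λ` on which
  `W` is `{0,1}`-valued along a pattern `ξ` (`W = 1` on `K ∩ ξ`, `W = 0` on `K ∖ ξ`), the configuration agrees with `ξ`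
  on `K` almost surely (the `null` field of fkt-p4's `IsPinningLaw` for `fkLaw`).

## References

* G. Grimmett, *The Random-Cluster Model*, Springer 2006: §1.4 eq. (1.20) (p. 15); Thm. (3.7) (p. 39). [Grimmett2006]
* G. Kozma, S. Nitzan, arXiv:2401.12397 (2024), §4 p. 20 (the events `ξ`), p. 30 (Step III, the auxiliary graph).
  [KozmaNitzan2024]
-/

noncomputable section

open MeasureTheory Finset SimpleGraph
open scoped ENNReal Classical

namespace Summit.CriticalPhenomena.PercolationContinuityZ3.Theorems.FK

open Literature.Probability.Percolation Literature.Probability.LatticeModels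
open Literature.Probability.Percolation.KozmaNitzan

variable {d : ℕ}

/-! ### The configuration is a lift -/

/-- An event whose pull-back along the lift is empty is null under the transplant's law. [cite: Grimmett2006, §1.4 eq. (1.20) (p. 15)] -/
theorem fkLaw_apply_eq_zero_of_preimage_eq_empty (Λ : Finset (Site d)) (W : Sym2 (Site d) → unitInterval) (q : ℝ)
    {N : Set (BondConfig (Site d))} (hN : MeasurableSet N) (hpre : liftEdges Λ ⁻¹' N = ∅) : fkLaw Λ W q N = 0 := by
  rw [fkLaw_apply Λ W q hN, hpre, measure_empty]

/-- A single pair off the range of the lift is never open under the transplant's law. [cite: Grimmett2006, §1.4 eq. (1.20) (p. 15)] -/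
theorem fkLaw_setOf_mem_eq_zero_of_not_mem_range (Λ : Finset (Site d)) (W : Sym2 (Site d) → unitInterval) (q : ℝ)
    {e : Sym2 (Site d)} (he : e ∉ Set.range (Sym2.map (Subtype.val : ↥Λ → Site d))) :
    fkLaw Λ W q {ω | e ∈ ω} = 0 := by
  refine fkLaw_apply_eq_zero_of_preimage_eq_empty Λ W q (measurableSet_mem e) ?_
  ext ω
  simp only [Set.mem_preimage, Set.mem_setOf_eq, Set.mem_empty_iff_false, iff_false, mem_liftEdges_iff]
  rintro ⟨e', -, rfl⟩
  exact he ⟨e', rfl⟩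

/-- **The configuration is a lift, almost surely**: under `fkLaw Λ W q` every open pair is the image of a pair of `↥Λ`.
[cite: Grimmett2006, §1.4 eq. (1.20) (p. 15)] -/
theorem fkLaw_ae_subset_range (Λ : Finset (Site d)) (W : Sym2 (Site d) → unitInterval) (q : ℝ) :
    ∀ᵐ ω ∂(fkLaw Λ W q), ω ⊆ Set.range (Sym2.map (Subtype.val : ↥Λ → Site d)) := by
  have h : ∀ᵐ ω ∂(fkLaw Λ W q), ∀ e ∈ (Set.range (Sym2.map (Subtype.val : ↥Λ → Site d)))ᶜ, e ∉ ω := by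
    rw [ae_ball_iff (Set.to_countable _)]
    intro e he
    rw [ae_iff]
    simp only [not_not]
    exact fkLaw_setOf_mem_eq_zero_of_not_mem_range Λ W q he
  filter_upwards [h] with ω hω e heω
  by_contra he
  exact hω e he heω

/-! ### Weight-zero pairs are closed almost surely -/

section Zero

variable {V : Type*} [Fintype V]

/-- Under `φ^B_{w,q}` a pair of parameter `0` is never open: `φ{ω | e ∈ ω} = 0` (every configuration containing `e` has a
factor `w_e = 0`). [cite: Grimmett2006, §1.4 eq. (1.20) (p. 15)] -/
theorem rcMeasureW_real_setOf_mem_eq_zero (w : Sym2 V → unitInterval) {q : ℝ} (hq : 0 < q) (B : Set V) {e : Sym2 V}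
    (he : w e = 0) : (rcMeasureW w q B).real {ω | e ∈ ω} = 0 := by
  rw [rcMeasureW_real_eq_sum_div w hq, Finset.sum_eq_zero, zero_div]
  intro ω _
  by_cases hω : e ∈ ω
  · have h0 : rcWeightW w q B ω = 0 := by
      unfold rcWeightW BHK2006.weight
      rw [Finset.prod_eq_zero (Finset.mem_univ e) (by rw [if_pos hω]; simp [he]), zero_mul]
    rw [h0, zero_mul]
  · rw [DecisionTree.ind_of_not_mem (show ω ∉ {ω : BondConfig V | e ∈ ω} from hω), mul_zero]

end Zero

/-- **A weight-zero pair is closed almost surely under the transplant's law**: `fkLaw Λ W q {ω | e ∈ ω} = 0` whenever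
`W e = 0` (`0 < q`). [cite: Grimmett2006, §1.4 eq. (1.20) (p. 15); Thm. (3.7)] -/
theorem fkLaw_setOf_mem_eq_zero_of_eq_zero (Λ : Finset (Site d)) {W : Sym2 (Site d) → unitInterval} {q : ℝ} (hq : 0 < q)
    {e : Sym2 (Site d)} (he : W e = 0) : fkLaw Λ W q {ω | e ∈ ω} = 0 := by
  by_cases hr : e ∈ Set.range (Sym2.map (Subtype.val : ↥Λ → Site d))
  · obtain ⟨e', rfl⟩ := hr
    haveI := isProbabilityMeasure_rcMeasureW (fun z : Sym2 ↥Λ => W (Sym2.map Subtype.val z)) hq (∅ : Set ↥Λ)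
    have hpre : liftEdges Λ ⁻¹' {ω : BondConfig (Site d) | Sym2.map Subtype.val e' ∈ ω} = {ω : BondConfig ↥Λ | e' ∈ ω} := by
      ext ω
      simp only [Set.mem_preimage, Set.mem_setOf_eq, mem_liftEdges_iff]
      constructor
      · rintro ⟨z, hz, hze⟩
        rwa [← (Sym2.map.injective Subtype.val_injective) hze]
      · exact fun h => ⟨e', h, rfl⟩
    rw [fkLaw_apply Λ W q (measurableSet_mem _), hpre, ← measureReal_eq_zero_iff (measure_ne_top _ _)]
    exact rcMeasureW_real_setOf_mem_eq_zero _ hq ∅ he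
  · exact fkLaw_setOf_mem_eq_zero_of_not_mem_range Λ W q hr

/-- **Weight-zero pairs are closed almost surely** (fkt-p2's `LawNull` for `fkLaw`): under `fkLaw Λ W q` (`0 < q`),
almost surely no pair of parameter `0` is open. [cite: Grimmett2006, §1.4 eq. (1.20) (p. 15); Thm. (3.7)] -/
theorem fkLaw_ae_not_mem_of_eq_zero (Λ : Finset (Site d)) (W : Sym2 (Site d) → unitInterval) {q : ℝ} (hq : 0 < q) :
    ∀ᵐ ω ∂(fkLaw Λ W q), ∀ e : Sym2 (Site d), W e = 0 → e ∉ ω := by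
  have h : ∀ᵐ ω ∂(fkLaw Λ W q), ∀ e ∈ {e : Sym2 (Site d) | W e = 0}, e ∉ ω := by
    rw [ae_ball_iff (Set.to_countable _)]
    intro e he
    rw [ae_iff]
    simp only [not_not]
    exact fkLaw_setOf_mem_eq_zero_of_eq_zero Λ hq he
  filter_upwards [h] with ω hω e he
  exact hω e he

/-! ### Weight-one pairs inside `Λ` are open almost surely -/

/-- **Weight-one pairs of `Λ` are open almost surely**: under `fkLaw Λ W q` (`0 < q`), almost surely every pair with
both endpoints in `Λ` and parameter `1` is open. [cite: Grimmett2006, §1.4 eq. (1.20) (p. 15); Thm. (3.7)] -/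
theorem fkLaw_ae_mem_of_eq_one (Λ : Finset (Site d)) (W : Sym2 (Site d) → unitInterval) {q : ℝ} (hq : 0 < q) :
    ∀ᵐ ω ∂(fkLaw Λ W q), ∀ e : Sym2 (Site d), (∀ x ∈ e, x ∈ Λ) → W e = 1 → e ∈ ω := by
  haveI := isProbabilityMeasure_fkLaw Λ W hq
  set K : Set (Sym2 (Site d)) := {e | (∀ x ∈ e, x ∈ Λ) ∧ W e = 1} with hK
  have hKc : K.Countable := Set.to_countable _
  have hKΛ : ∀ e ∈ K, ∀ x ∈ e, x ∈ Λ := fun e he => he.1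
  have hK1 : ∀ e ∈ K, W e = 1 := fun e he => he.2
  have h1 : (fkLaw Λ W q).real {ω | K ⊆ ω} = 1 := by
    have h := fkLaw_real_inter_setOf_subset_eq Λ hq hKc hKΛ hK1 MeasurableSet.univ
    rwa [Set.univ_inter, probReal_univ] at h
  have h2 : ∀ᵐ ω ∂(fkLaw Λ W q), K ⊆ ω := by
    rw [ae_iff]
    have hm := measurableSet_setOf_setSubset (ι := Sym2 (Site d)) hKc
    have hc : (fkLaw Λ W q).real {ω | K ⊆ ω}ᶜ = 0 := by
      rw [probReal_compl_eq_one_sub hm, h1, sub_self]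
    rw [measureReal_eq_zero_iff (measure_ne_top _ _)] at hc
    exact hc
  filter_upwards [h2] with ω hω e heΛ he
  exact hω ⟨heΛ, he⟩

/-- **Weight-one pairs inside `Λ` are open almost surely** (fkt-p2's `LawOne` for `fkLaw`): the off-diagonal pairs of
`wireSet Λ` with parameter `1` are open a.s. [cite: Grimmett2006, §1.4 eq. (1.20) (p. 15); Thm. (3.7)] -/
theorem fkLaw_ae_mem_of_eq_one_of_mem_wireSet (Λ : Finset (Site d)) (W : Sym2 (Site d) → unitInterval) {q : ℝ}
    (hq : 0 < q) :
    ∀ᵐ ω ∂(fkLaw Λ W q), ∀ e ∈ wireSet (↑Λ : Set (Site d)), W e = 1 → e ∈ ω := by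
  filter_upwards [fkLaw_ae_mem_of_eq_one Λ W hq] with ω hω e he h1
  exact hω e (fun x hx => Finset.mem_coe.1 (he.1 x hx)) h1

/-! ### Pinned pairs follow their pattern almost surely -/

/-- **`{0,1}`-pinned pairs follow their pattern almost surely**: if `K` is a set of pairs inside `Λ` and `W = 1` on
`K ∩ ξ`, `W = 0` on `K ∖ ξ`, then under `fkLaw Λ W q` (`0 < q`) the configuration lies in the cylinder
`localCylinder K ξ` almost surely (Kozma–Nitzan's events "`ξ`": the pinned law charges only configurations extending
`ξ` on `K`). [cite: KozmaNitzan2024, §4 p. 20 (the events ξ); Grimmett2006, Thm. (3.7)] -/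
theorem fkLaw_ae_mem_localCylinder (Λ : Finset (Site d)) (W : Sym2 (Site d) → unitInterval) {q : ℝ} (hq : 0 < q)
    {K ξ : Set (Sym2 (Site d))} (hKΛ : ∀ e ∈ K, ∀ x ∈ e, x ∈ Λ) (h1 : ∀ e ∈ K, e ∈ ξ → W e = 1)
    (h0 : ∀ e ∈ K, e ∉ ξ → W e = 0) :
    ∀ᵐ ω ∂(fkLaw Λ W q), ω ∈ localCylinder K ξ := by
  filter_upwards [fkLaw_ae_not_mem_of_eq_zero Λ W hq, fkLaw_ae_mem_of_eq_one Λ W hq] with ω hω0 hω1 e he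
  by_cases heξ : e ∈ ξ
  · exact ⟨fun _ => heξ, fun _ => hω1 e (hKΛ e he) (h1 e he heξ)⟩
  · exact ⟨fun heω => (hω0 e (h0 e he heξ) heω).elim, fun h => (heξ h).elim⟩

/-- The same, as a null set: `fkLaw Λ W q ((localCylinder K ξ)ᶜ) = 0` (the `null` field of a pinning law for `fkLaw`).
[cite: KozmaNitzan2024, §4 p. 20 (the events ξ); Grimmett2006, Thm. (3.7)] -/
theorem fkLaw_compl_localCylinder_eq_zero (Λ : Finset (Site d)) (W : Sym2 (Site d) → unitInterval) {q : ℝ} (hq : 0 < q)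
    {K ξ : Set (Sym2 (Site d))} (hKΛ : ∀ e ∈ K, ∀ x ∈ e, x ∈ Λ) (h1 : ∀ e ∈ K, e ∈ ξ → W e = 1)
    (h0 : ∀ e ∈ K, e ∉ ξ → W e = 0) : fkLaw Λ W q (localCylinder K ξ)ᶜ = 0 :=
  ae_iff.1 (fkLaw_ae_mem_localCylinder Λ W hq hKΛ h1 h0)

/-- Real-valued form: `(fkLaw Λ W q).real ((localCylinder K ξ)ᶜ) = 0`. [cite: KozmaNitzan2024, §4 p. 20; Grimmett2006, Thm. (3.7)] -/
theorem fkLaw_real_compl_localCylinder_eq_zero (Λ : Finset (Site d)) (W : Sym2 (Site d) → unitInterval) {q : ℝ}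
    (hq : 0 < q) {K ξ : Set (Sym2 (Site d))} (hKΛ : ∀ e ∈ K, ∀ x ∈ e, x ∈ Λ) (h1 : ∀ e ∈ K, e ∈ ξ → W e = 1)
    (h0 : ∀ e ∈ K, e ∉ ξ → W e = 0) : (fkLaw Λ W q).real (localCylinder K ξ)ᶜ = 0 := by
  rw [measureReal_def, fkLaw_compl_localCylinder_eq_zero Λ W hq hKΛ h1 h0, ENNReal.toReal_zero]

end Summit.CriticalPhenomena.PercolationContinuityZ3.Theorems.FK

end
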